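import Summits.Ventures.DiscreteObjects.Hadamard.ConferenceGraph333Order11CharacterTest

/-!
# The partial-Hadamard rank tests for an automorphism of prime order with a conference-type fixed block (general kernel form)

Framing: lottery ticket; floor = certified bounds/negative ranges.  Cell pub-namedobj (venture DiscreteObjects),
target (H) = `H(668)`, hadamard gen 32.  GENERAL form of the two kernel rank tests of gens 31/32
(`ConferenceGraph333Order11RankTest.aut_order11_commuting_rank_test`, `ConferenceGraph333Order11CharacterTest.aut_order11_commuting_character_test`),
with the prime `p`, the fixed set and the block constant as PARAMETERS, so that the extremal cases `p = 7` (`25` fixed vertices), `p = 5` (`13`),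
`p = 3` (`9`) of `ConferenceGraph333FixedBlockOrthogonal` are covered as well (instances in `ConferenceGraph333ExtremalRankTests`).
Setting: `A` a symmetric `0/1` matrix, `ρ` an `A`-preserving permutation with `ρ^p = 1` (`p` prime) whose fixed-by-moved block satisfies
`Σ_{z moved} A_{yz} = 2K` for fixed `y` and `Σ_{z moved} A_{yz}A_{zy'} = K ≠ 0` for fixed `y ≠ y'`; `σ` an `A`-preserving permutation commuting
with `ρ`, `σ^N = 1`.  With `B_{y,O} = A_{y,x}` (`x ∈ O`, `O` a `ρ`-orbit of size `p`), `B Bᵀ = (K/p)(I + J)`, `K' = (p/K)(I − J/(f+1))`, and the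
permutation matrices `R`, `P` of `σ` on `Fix ρ` / on the orbits (`B P = R B`, powers = matrices of the powers of `σ`):
* **`fixedBlock_commuting_rank_tests`** — writing `T_j = #{x : ρx ≠ x, σʲx ∈ ⟨ρ⟩x}` (`= p ×` number of `σʲ`-invariant orbits),
  `f_j = #{x : σʲx = x, ρx = x}`, `M = #{x : ρx ≠ x}`, `f = #Fix ρ`:
  (1) `(T_j − p f_j)² ≤ (M − p f)²` for every `j` (trace bound, `IntertwinedTraceBound`), and
  (2) `0 ≤ Σ_{j<N} (T_j − p f_j)` (averaged / trivial-character multiplicity, `IntertwinedTraceAverage`).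
WORDS: an elementary general lemma (ours); used for the STRUCTURE census of a HYPOTHETICAL srg(333,166,82,83) — nothing about H(668) is excluded.
No `sorry`, no new definitions.
-/

namespace Summit.Ventures.DiscreteObjects.Hadamard

open Finset Matrix

section fixedBlockRankTests
variable {V : Type*} [Fintype V] [DecidableEq V]

/-- **Rank tests for a prime-order automorphism with a conference-type fixed block** (trace bound for every power, and the averaged test). -/
theorem fixedBlock_commuting_rank_tests (A : Matrix V V ℤ)
    (h01 : ∀ x y, A x y = 0 ∨ A x y = 1) (hsymm : ∀ x y, A y x = A x y)
    {p : ℕ} (hp : p.Prime) (ρ : Equiv.Perm V) (hρ : ρ ^ p = 1) (hAρ : ∀ x y, A (ρ x) (ρ y) = A x y)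
    {K : ℤ} (hK0 : K ≠ 0)
    (hblk1 : ∀ y ∈ univ.filter (fun x => ρ x = x), ∑ z ∈ univ \ univ.filter (fun x => ρ x = x), A y z = 2 * K)
    (hblk2 : ∀ y ∈ univ.filter (fun x => ρ x = x), ∀ y' ∈ univ.filter (fun x => ρ x = x), y ≠ y' →
      ∑ z ∈ univ \ univ.filter (fun x => ρ x = x), A y z * A z y' = K)
    (σ : Equiv.Perm V) (hc : σ * ρ = ρ * σ) (hAσ : ∀ x y, A (σ x) (σ y) = A x y)
    {N : ℕ} (hN : 0 < N) (hσN : σ ^ N = 1) :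
    (∀ j : ℕ,
      (((univ.filter fun x => ρ x ≠ x ∧ (σ ^ j) x ∈ (Finset.range p).image (fun k => (ρ ^ k) x)).card : ℤ)
          - p * ((univ.filter fun x => (σ ^ j) x = x ∧ ρ x = x).card : ℤ)) ^ 2
        ≤ (((univ.filter fun x => ρ x ≠ x).card : ℤ) - p * ((univ.filter fun x => ρ x = x).card : ℤ)) ^ 2) ∧
    0 ≤ ∑ j ∈ Finset.range N,
      (((univ.filter fun x => ρ x ≠ x ∧ (σ ^ j) x ∈ (Finset.range p).image (fun k => (ρ ^ k) x)).card : ℤ)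
        - p * ((univ.filter fun x => (σ ^ j) x = x ∧ ρ x = x).card : ℤ)) := by
  classical
  have hp0 : (p : ℚ) ≠ 0 := by exact_mod_cast hp.ne_zero
  have hppos : (0 : ℚ) < p := by exact_mod_cast hp.pos
  have hK0q : (K : ℚ) ≠ 0 := by exact_mod_cast hK0
  -- commuting facts on points (for every power of σ)
  have hcx : ∀ x, σ (ρ x) = ρ (σ x) := fun x => by
    have := congrArg (fun g : Equiv.Perm V => g x) hc; simpa using this
  have hcomm : ∀ j : ℕ, σ ^ j * ρ = ρ * σ ^ j := fun j => ((show Commute σ ρ from hc).pow_left j).eq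
  have hcxj : ∀ (j : ℕ) x, (σ ^ j) (ρ x) = ρ ((σ ^ j) x) := fun j x => by
    have := congrArg (fun g : Equiv.Perm V => g x) (hcomm j); simpa using this
  have hckj : ∀ (j k : ℕ) x, (σ ^ j) ((ρ ^ k) x) = (ρ ^ k) ((σ ^ j) x) := by
    intro j k; induction k with
    | zero => intro x; simp
    | succ k ih => intro x; rw [pow_succ', Equiv.Perm.mul_apply, Equiv.Perm.mul_apply, hcxj, ih]
  have hck : ∀ (k : ℕ) x, σ ((ρ ^ k) x) = (ρ ^ k) (σ x) := fun k x => by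
    have := hckj 1 k x; rwa [pow_one] at this
  -- orbits of ρ
  set orb : V → Finset V := fun x => (Finset.range p).image (fun k => (ρ ^ k) x) with horb
  have horb_mem : ∀ x y, y ∈ orb x ↔ orb y = orb x := fun x y => mem_orbP_iff ρ hp.pos hρ x y
  have horb_self : ∀ x, x ∈ orb x := fun x => (horb_mem x x).mpr rfl
  have horb_pow : ∀ (k : ℕ) x, orb ((ρ ^ k) x) = orb x := fun k x =>
    (horb_mem x _).mp (Finset.mem_image.mpr ⟨k % p, Finset.mem_range.mpr (Nat.mod_lt _ hp.pos),
      (perm_pow_apply_mod ρ hρ k x).symm⟩)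
  have horb_moved : ∀ x, ρ x ≠ x → ∀ z ∈ orb x, ρ z ≠ z := by
    intro x hx z hz h
    obtain ⟨k, -, rfl⟩ := Finset.mem_image.mp hz
    exact hx ((ρ ^ k).injective (by rw [perm_pow_apply_comm]; exact h))
  have horb_τ : ∀ (j : ℕ) x, orb ((σ ^ j) x) = (orb x).image (σ ^ j) := by
    intro j x; simp only [horb]; rw [Finset.image_image]
    refine Finset.image_congr fun k _ => ?_
    show (ρ ^ k) ((σ ^ j) x) = ((σ ^ j) ∘ fun k => (ρ ^ k) x) k
    simp [hckj]
  have horb_σ : ∀ x, orb (σ x) = (orb x).image σ := fun x => by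
    have := horb_τ 1 x; rwa [pow_one] at this
  -- the orbit index type
  set S := (univ.filter fun x => ρ x ≠ x).image orb with hS
  set ι := {j : Finset V // j ∈ S} with hι
  have hrep : ∀ i : ι, ∃ x, ρ x ≠ x ∧ orb x = i.1 := fun i => by
    obtain ⟨x, hx, hxe⟩ := Finset.mem_image.mp i.2
    exact ⟨x, (Finset.mem_filter.mp hx).2, hxe⟩
  choose rep hrep_moved hrep_orb using hrep
  have hrep_mem : ∀ i : ι, rep i ∈ i.1 := fun i => by rw [← hrep_orb i]; exact horb_self _
  -- fixed points as a subtype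
  have hFcard : (Fintype.card {y : V // ρ y = y} : ℚ) = ((univ.filter fun x => ρ x = x).card : ℚ) := by
    rw [Fintype.card_subtype]
  have hf1 : ((univ.filter fun x => ρ x = x).card : ℚ) + 1 ≠ 0 := by positivity
  -- sums over the moved vertices = p · sums over orbit representatives, for orbit-invariant functions
  have hdisj : Set.PairwiseDisjoint (↑(univ : Finset ι)) (fun i : ι => (i.1 : Finset V)) := by
    intro i _ i' _ hne
    show Disjoint i.1 i'.1
    rw [Finset.disjoint_left]
    intro z hz hz'
    apply hne; apply Subtype.ext
    rw [← hrep_orb i] at hz; rw [← hrep_orb i'] at hz'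
    rw [← hrep_orb i, ← hrep_orb i', ← (horb_mem _ _).mp hz, ← (horb_mem _ _).mp hz']
  have hcover : (univ.filter fun x => ρ x ≠ x) = (univ : Finset ι).biUnion (fun i => i.1) := by
    ext z
    rw [Finset.mem_filter, Finset.mem_biUnion]
    constructor
    · rintro ⟨-, hz⟩
      refine ⟨⟨orb z, Finset.mem_image.mpr ⟨z, Finset.mem_filter.mpr ⟨Finset.mem_univ _, hz⟩, rfl⟩⟩, Finset.mem_univ _, horb_self z⟩
    · rintro ⟨i, -, hz⟩
      rw [← hrep_orb i] at hz
      exact ⟨Finset.mem_univ _, horb_moved _ (hrep_moved i) z hz⟩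
  have hsum : ∀ g : V → ℚ, (∀ x (k : ℕ), ρ x ≠ x → g ((ρ ^ k) x) = g x) →
      ∑ z ∈ univ.filter (fun x => ρ x ≠ x), g z = p * ∑ i : ι, g (rep i) := by
    intro g hg
    rw [hcover, Finset.sum_biUnion hdisj, Finset.mul_sum]
    refine Finset.sum_congr rfl fun i _ => ?_
    rw [← hrep_orb i]
    simp only [horb]
    rw [Finset.sum_image (orbP_injOn ρ hp hρ (rep i) (hrep_moved i))]
    rw [Finset.sum_congr rfl fun k _ => hg (rep i) k (hrep_moved i), Finset.sum_const, Finset.card_range, nsmul_eq_mul]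
  have hpι : (p : ℚ) * (Fintype.card ι : ℚ) = ((univ.filter fun x => ρ x ≠ x).card : ℚ) := by
    have h1 := hsum (fun _ => 1) (fun _ _ _ => rfl)
    rw [Finset.sum_const, Finset.sum_const, Finset.card_univ, nsmul_eq_mul, nsmul_eq_mul, mul_one, mul_one] at h1
    exact h1.symm
  -- the induced permutations
  have hkey : ∀ y, ρ (σ y) = σ y ↔ ρ y = y := fun y => by
    constructor
    · intro hy; rw [← hcx] at hy; exact σ.injective hy
    · intro hy; rw [← hcx, hy]
  set σF : Equiv.Perm {y : V // ρ y = y} := σ.subtypePerm hkey with hσF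
  have hSperm : ∀ j : Finset V, j ∈ S ↔ σ.finsetCongr j ∈ S := by
    intro j
    rw [Equiv.finsetCongr_apply, Finset.map_eq_image]
    constructor
    · intro hj
      obtain ⟨x, hx, rfl⟩ := Finset.mem_image.mp hj
      have hxm := (Finset.mem_filter.mp hx).2
      refine Finset.mem_image.mpr ⟨σ x, Finset.mem_filter.mpr ⟨Finset.mem_univ _, fun h => hxm ?_⟩, ?_⟩
      · rw [← hcx] at h; exact σ.injective h
      · show orb (σ x) = Finset.image (⇑σ.toEmbedding) (orb x)
        rw [horb_σ]; rfl
    · intro hj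
      obtain ⟨x', hx', hxe⟩ := Finset.mem_image.mp hj
      have hx'm := (Finset.mem_filter.mp hx').2
      refine Finset.mem_image.mpr ⟨σ.symm x', Finset.mem_filter.mpr ⟨Finset.mem_univ _, fun h => hx'm ?_⟩, ?_⟩
      · have h2 := congrArg σ h
        rwa [hcx, Equiv.apply_symm_apply] at h2
      · have e1 : (orb (σ.symm x')).image σ = orb x' := by rw [← horb_σ, Equiv.apply_symm_apply]
        have e2 : (orb (σ.symm x')).image σ = Finset.image (⇑σ.toEmbedding) j := by rw [e1, hxe]
        exact Finset.image_injective σ.injective e2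
  set πσ : Equiv.Perm ι := Equiv.Perm.subtypePerm (σ.finsetCongr : Equiv.Perm (Finset V)) (fun j => (hSperm j).symm)
    with hπσ
  have hπσ_val : ∀ i : ι, (πσ i).1 = i.1.image σ := fun i => by
    show (σ.finsetCongr i.1) = i.1.image σ
    rw [Equiv.finsetCongr_apply, Finset.map_eq_image]; rfl
  have hσF_val : ∀ y : {y : V // ρ y = y}, (σF y).1 = σ y.1 := fun y => rfl
  have hπσ_pow_val : ∀ (j : ℕ) (i : ι), ((πσ ^ j) i).1 = i.1.image (σ ^ j) := by
    intro j; induction j with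
    | zero => intro i; rw [pow_zero, pow_zero, Equiv.Perm.one_apply, Equiv.Perm.coe_one, Finset.image_id]
    | succ j ih =>
      intro i
      rw [pow_succ', Equiv.Perm.mul_apply, hπσ_val, ih, Finset.image_image, ← Equiv.Perm.coe_mul, ← pow_succ']
  have hσF_pow_val : ∀ (j : ℕ) (y : {y : V // ρ y = y}), ((σF ^ j) y).1 = (σ ^ j) y.1 := by
    intro j; induction j with
    | zero => intro y; rw [pow_zero, pow_zero, Equiv.Perm.one_apply, Equiv.Perm.one_apply]
    | succ j ih => intro y; rw [pow_succ', pow_succ', Equiv.Perm.mul_apply, Equiv.Perm.mul_apply, hσF_val, ih]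
  -- matrices
  set B : Matrix {y : V // ρ y = y} ι ℚ := fun y i => (A y.1 (rep i) : ℚ) with hB
  set Jm : Matrix {y : V // ρ y = y} {y : V // ρ y = y} ℚ := Matrix.of fun _ _ => (1 : ℚ) with hJm
  set Km : Matrix {y : V // ρ y = y} {y : V // ρ y = y} ℚ :=
    ((p : ℚ) / K) • (1 - (1 / (((univ.filter fun x => ρ x = x).card : ℚ) + 1)) • Jm) with hKm
  set R : Matrix {y : V // ρ y = y} {y : V // ρ y = y} ℚ := Matrix.of fun a b => if σF a = b then (1 : ℚ) else 0 with hR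
  set P : Matrix ι ι ℚ := Matrix.of fun a b => if πσ a = b then (1 : ℚ) else 0 with hP
  -- row constancy on orbits (fixed rows)
  have hrow : ∀ (y : {y : V // ρ y = y}) (z : V) (k : ℕ), A y.1 ((ρ ^ k) z) = A y.1 z := fun y z k =>
    aut_fixed_row_orbit_constant A ρ hAρ y.2 z k
  -- B Bᵀ = (K/p) (1 + J)
  have hsdiff : (univ \ univ.filter fun x : V => ρ x = x) = univ.filter fun x => ρ x ≠ x := by
    ext z; simp
  have hBBt : B * Bᵀ = ((K : ℚ) / p) • (1 + Jm) := by
    ext y y'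
    simp only [Matrix.mul_apply, Matrix.transpose_apply, hB, Matrix.smul_apply, Matrix.add_apply, Matrix.one_apply, hJm,
      Matrix.of_apply, smul_eq_mul]
    have hg := hsum (fun z => (A y.1 z : ℚ) * (A y'.1 z : ℚ)) (fun x k _ => by simp only [hrow])
    by_cases hyy : y = y'
    · subst hyy
      rw [if_pos rfl]
      have h2K : ∑ z ∈ univ.filter (fun x => ρ x ≠ x), (A y.1 z : ℚ) * (A y.1 z : ℚ) = 2 * K := by
        have e : ∀ z, (A y.1 z : ℚ) * (A y.1 z : ℚ) = (A y.1 z : ℚ) := fun z => by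
          rcases h01 y.1 z with h | h <;> simp [h]
        rw [Finset.sum_congr rfl fun z _ => e z, ← hsdiff]
        have := hblk1 y.1 (Finset.mem_filter.mpr ⟨Finset.mem_univ _, y.2⟩)
        exact_mod_cast this
      rw [h2K] at hg
      rw [show (K : ℚ) / p * (1 + 1) = 2 * K / p by ring, eq_div_iff hp0]
      linarith
    · rw [if_neg hyy]
      have hne : y.1 ≠ y'.1 := fun h => hyy (Subtype.ext h)
      have h1K : ∑ z ∈ univ.filter (fun x => ρ x ≠ x), (A y.1 z : ℚ) * (A y'.1 z : ℚ) = K := by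
        rw [← hsdiff]
        have := hblk2 y.1 (Finset.mem_filter.mpr ⟨Finset.mem_univ _, y.2⟩) y'.1
          (Finset.mem_filter.mpr ⟨Finset.mem_univ _, y'.2⟩) hne
        rw [Finset.sum_congr rfl fun z _ => by rw [hsymm z y'.1]]
        exact_mod_cast this
      rw [h1K] at hg
      rw [show (K : ℚ) / p * (0 + 1) = K / p by ring, eq_div_iff hp0]
      linarith
  -- J² = f J and B Bᵀ Km = 1
  have hJJ : Jm * Jm = ((univ.filter fun x => ρ x = x).card : ℚ) • Jm := by
    ext a b
    simp only [Matrix.mul_apply, hJm, Matrix.of_apply, Matrix.smul_apply, smul_eq_mul, mul_one, Finset.sum_const,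
      Finset.card_univ, nsmul_eq_mul]
    rw [hFcard]
  have hJinv : (1 + Jm) * (1 - (1 / (((univ.filter fun x => ρ x = x).card : ℚ) + 1)) • Jm) = 1 := by
    rw [Matrix.add_mul, Matrix.one_mul, Matrix.mul_sub, Matrix.mul_one, Matrix.mul_smul, hJJ, smul_smul]
    ext a b
    simp only [Matrix.sub_apply, Matrix.add_apply, Matrix.one_apply, Matrix.smul_apply, hJm, Matrix.of_apply, smul_eq_mul, mul_one]
    have hc : (1 : ℚ) - 1 / (((univ.filter fun x => ρ x = x).card : ℚ) + 1)
        - 1 / (((univ.filter fun x => ρ x = x).card : ℚ) + 1) * ((univ.filter fun x => ρ x = x).card : ℚ) = 0 := by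
      field_simp
      ring
    split_ifs <;> linarith
  have hBK : B * Bᵀ * Km = 1 := by
    rw [hBBt, hKm, Matrix.smul_mul, Matrix.mul_smul, smul_smul, hJinv]
    have hcoef : (K : ℚ) / p * ((p : ℚ) / K) = 1 := by
      field_simp
    rw [hcoef, one_smul]
  have hJt : Jmᵀ = Jm := by ext a b; rfl
  have hKt : Kmᵀ = Km := by
    rw [hKm, Matrix.transpose_smul, Matrix.transpose_sub, Matrix.transpose_one, Matrix.transpose_smul, hJt]
  -- orthogonality, J-compatibility (for all powers)
  have hRtR : Rᵀ * R = 1 := by rw [hR]; exact perm01_transpose_mul_self σF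
  have hPtP : Pᵀ * P = 1 := by rw [hP]; exact perm01_transpose_mul_self πσ
  have hRKe : ∀ e : Equiv.Perm {y : V // ρ y = y},
      (Matrix.of fun a b => if e a = b then (1 : ℚ) else 0) * Km = Km * (Matrix.of fun a b => if e a = b then (1 : ℚ) else 0) := by
    intro e
    obtain ⟨hRJ, hJR⟩ := perm01_mul_allOnes e
    rw [hKm, Matrix.mul_smul, Matrix.smul_mul, Matrix.mul_sub, Matrix.sub_mul, Matrix.mul_one, Matrix.one_mul,
      Matrix.mul_smul, Matrix.smul_mul, hJm, hRJ, hJR]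
  have hRK : R * Km = Km * R := by rw [hR]; exact hRKe σF
  -- intertwining B P = R B
  have hBP : B * P = R * B := by
    ext y j
    rw [hP, perm01_mul_right πσ B y j, hR, perm01_mul_left σF B y j]
    simp only [hB, hσF_val]
    set i₀ := πσ.symm j with hi₀
    have hval : (πσ i₀).1 = j.1 := by rw [hi₀, Equiv.apply_symm_apply]
    rw [hπσ_val] at hval
    have hmem : σ (rep i₀) ∈ orb (rep j) := by
      rw [hrep_orb j, ← hval]; exact Finset.mem_image_of_mem _ (hrep_mem i₀)
    obtain ⟨k, -, hk'⟩ := Finset.mem_image.mp hmem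
    have e1 : A y.1 (rep i₀) = A (σ y.1) (σ (rep i₀)) := (hAσ y.1 (rep i₀)).symm
    rw [e1, ← hk']
    have hσy : ρ (σ y.1) = σ y.1 := by rw [← hcx, y.2]
    exact_mod_cast aut_fixed_row_orbit_constant A ρ hAρ hσy (rep j) k
  have hBPk : ∀ k : ℕ, B * P ^ k = R ^ k * B := by
    intro k; induction k with
    | zero => simp
    | succ k ih => rw [pow_succ, ← Matrix.mul_assoc, ih, Matrix.mul_assoc, hBP, ← Matrix.mul_assoc, ← pow_succ]
  -- P has finite order N
  have hπσN : πσ ^ N = 1 := by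
    refine Equiv.ext fun i => Subtype.ext ?_
    rw [hπσ_pow_val, hσN, Equiv.Perm.one_apply, Equiv.Perm.coe_one, Finset.image_id]
  have hPN : P ^ N = 1 := by
    rw [hP, perm01_pow, hπσN]
    ext a b
    simp only [Matrix.of_apply, Equiv.Perm.one_apply, Matrix.one_apply]
    split_ifs <;> rfl
  -- identify the traces of the powers
  have htrP : ∀ j, trace (P ^ j) = ((univ.filter fun a : ι => (πσ ^ j) a = a).card : ℚ) := fun j => by
    rw [hP, perm01_pow, perm01_trace]
  have htrR : ∀ j, trace (R ^ j) = ((univ.filter fun a : {y : V // ρ y = y} => (σF ^ j) a = a).card : ℚ) := fun j => by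
    rw [hR, perm01_pow, perm01_trace]
  have hcountR : ∀ j, (univ.filter fun a : {y : V // ρ y = y} => (σF ^ j) a = a).card =
      (univ.filter fun x => (σ ^ j) x = x ∧ ρ x = x).card := fun j => by
    rw [← Fintype.card_subtype, ← Fintype.card_subtype]
    refine Fintype.card_congr ⟨fun a => ⟨a.1.1, ?_, a.1.2⟩, fun x => ⟨⟨x.1, x.2.2⟩, ?_⟩, fun a => rfl, fun x => rfl⟩
    · have := congrArg Subtype.val a.2; rwa [hσF_pow_val] at this
    · exact Subtype.ext ((hσF_pow_val _ _).trans x.2.1)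
  have hcountP : ∀ j, ((univ.filter fun x => ρ x ≠ x ∧ (σ ^ j) x ∈ orb x).card : ℚ) =
      p * ((univ.filter fun a : ι => (πσ ^ j) a = a).card : ℚ) := fun j => by
    have hg := hsum (fun z => if (σ ^ j) z ∈ orb z then (1 : ℚ) else 0) (fun x k _ => by
      show (if (σ ^ j) ((ρ ^ k) x) ∈ orb ((ρ ^ k) x) then (1 : ℚ) else 0) = if (σ ^ j) x ∈ orb x then 1 else 0
      rw [horb_pow, hckj]
      have : (ρ ^ k) ((σ ^ j) x) ∈ orb x ↔ (σ ^ j) x ∈ orb x := by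
        rw [horb_mem, horb_mem, horb_pow]
      simp only [this])
    rw [Finset.sum_boole, Finset.sum_boole, Finset.filter_filter] at hg
    have hfix : (univ.filter fun i : ι => (σ ^ j) (rep i) ∈ orb (rep i)) = univ.filter fun a : ι => (πσ ^ j) a = a := by
      refine Finset.filter_congr fun i _ => ?_
      rw [horb_mem, horb_τ, hrep_orb, ← hπσ_pow_val]
      constructor
      · intro h; exact Subtype.ext h
      · intro h; rw [h]
    rw [hfix] at hg
    exact hg
  refine ⟨fun j => ?_, ?_⟩
  · -- the trace bound for the power j
    have hmain := trace_sub_sq_le_of_intertwining B Km hBK hKt (R ^ j) (P ^ j)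
      (by rw [hR, perm01_pow]; exact perm01_transpose_mul_self _)
      (by rw [hP, perm01_pow]; exact perm01_transpose_mul_self _)
      (by rw [hR, perm01_pow]; exact hRKe _) (hBPk j)
    rw [htrP, htrR, hcountR, hFcard] at hmain
    have h' : ((((univ.filter fun x => ρ x ≠ x ∧ (σ ^ j) x ∈ orb x).card : ℚ)
          - p * ((univ.filter fun x => (σ ^ j) x = x ∧ ρ x = x).card : ℚ)) ^ 2
        ≤ (((univ.filter fun x => ρ x ≠ x).card : ℚ) - p * ((univ.filter fun x => ρ x = x).card : ℚ)) ^ 2) := by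
      rw [hcountP j, ← hpι]
      have e1 : ((p : ℚ) * ((univ.filter fun a : ι => (πσ ^ j) a = a).card : ℚ)
            - p * ((univ.filter fun x => (σ ^ j) x = x ∧ ρ x = x).card : ℚ)) ^ 2
          = (p : ℚ) ^ 2 * ((((univ.filter fun a : ι => (πσ ^ j) a = a).card : ℚ))
            - ((univ.filter fun x => (σ ^ j) x = x ∧ ρ x = x).card : ℚ)) ^ 2 := by ring
      have e2 : ((p : ℚ) * (Fintype.card ι : ℚ) - p * ((univ.filter fun x => ρ x = x).card : ℚ)) ^ 2
          = (p : ℚ) ^ 2 * ((Fintype.card ι : ℚ) - ((univ.filter fun x => ρ x = x).card : ℚ)) ^ 2 := by ring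
      rw [e1, e2]
      exact mul_le_mul_of_nonneg_left hmain (sq_nonneg _)
    exact_mod_cast h'
  · -- the averaged test
    have hmain := trace_pow_sub_sum_nonneg_of_intertwining B Km hBK hKt R P hRtR hPtP hRK hBP hN hPN
    have e : ∀ j, trace (P ^ j) - trace (R ^ j) =
        (1 / p : ℚ) * (((univ.filter fun x => ρ x ≠ x ∧ (σ ^ j) x ∈ orb x).card : ℚ)
          - p * ((univ.filter fun x => (σ ^ j) x = x ∧ ρ x = x).card : ℚ)) := fun j => by
      rw [htrP, htrR, hcountR, hcountP]
      field_simp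
    rw [Finset.sum_congr rfl fun j _ => e j, ← Finset.mul_sum] at hmain
    have h' : (0 : ℚ) ≤ ∑ j ∈ Finset.range N, (((univ.filter fun x => ρ x ≠ x ∧ (σ ^ j) x ∈ orb x).card : ℚ)
          - p * ((univ.filter fun x => (σ ^ j) x = x ∧ ρ x = x).card : ℚ)) :=
      (mul_nonneg_iff_of_pos_left (by positivity)).mp hmain
    exact_mod_cast h'

end fixedBlockRankTests

end Summit.Ventures.DiscreteObjects.Hadamard
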